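import Summits.QuantumFields.YangMills.Theorems.CurvatureKernelBound.Negative.UVScaling

/-!
# `CurvatureKernelBound` — negative lemmas III: pinning (the `∃ K` is a property of THE kernel)

Supports crux item `stmt-QuantumFields-11687` (`PencilRigidity.CurvatureKernelBound`: for every compact simple
`G`, `r`, `sch` and one-species `S₁` carrying the curvature package `W₁`, the two-point function of `S₁` on `⁰𝒮`
is integration against a REAL kernel `K(x₀ − x₁)`, continuous off `0`, with `|K x| ≤ C (1 + ‖x‖^(η−10))`,
`η > 0`). Standing disprover's negative lemmas (refuter, cdisprove); no conclusion below asserts a Theses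
statement positively.

§C. A kernel continuous off `0` whose integral against every compactly supported off-diagonal bump tensor
vanishes is zero off `0` (`kernel_eq_zero_off_origin`: `ContDiffBump` tensors at `(x, 0)`, positivity of the
integral of a continuous non-negative non-zero compactly supported function); two kernels continuous off `0`
representing the same two-point functional on `⁰𝒮` agree off `0` (`kernel_unique`); hence the `∃ K` of the
crux holds iff THE representing kernel (e.g. the explicit lattice-limit kernel) carries the bound
(`representsCLM_kernelData_iff`, `kernelConclusion_iff_of_represents`): provers bound it, refuters read the
counterexample off it. (The lead's `Theorems.CurvatureKernel.kernel_unique_of_realTensor` is the real-tensor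
variant; this file is the compactly-supported-off-diagonal variant used by the UV-scaling criterion.) [folklore]
-/

open scoped BigOperators Topology SchwartzMap
open MeasureTheory Filter Set
open Literature.MathematicalPhysics.QuantumLattice Literature.MathematicalPhysics.AQFT
  Literature.MathematicalPhysics.QuantumFieldTheory

noncomputable section

namespace Summit.QuantumFields.YangMills.Theorems.CurvatureKernelBound.Negative

/-! ## §C Pinning: the kernel of the conclusion is THE two-point kernel -/

section Pinning

/-- The real bump `x ↦ b x` as a complex-valued Schwartz function. -/
def bumpSchwartz {c : E4} (b : ContDiffBump c) : 𝓢(E4, ℂ) :=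
  (b.hasCompactSupport.comp_left Complex.ofReal_zero).toSchwartzMap
    (Complex.ofRealCLM.contDiff.comp b.contDiff)

/-- Pointwise formula for `bumpSchwartz`. [folklore] -/
@[simp] theorem bumpSchwartz_apply {c : E4} (b : ContDiffBump c) (x : E4) :
    bumpSchwartz b x = ((b x : ℝ) : ℂ) := rfl

/-- The two-point tensor `g ⊗ h` of two bumps. -/
def bumpTensor {c₀ c₁ : E4} (g : ContDiffBump c₀) (h : ContDiffBump c₁) : 𝓢((Fin 2 → E4), ℂ) :=
  SchwartzMap.tensorFin 2 ![bumpSchwartz g, bumpSchwartz h]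

/-- Pointwise formula for `bumpTensor`. [folklore] -/
theorem bumpTensor_apply {c₀ c₁ : E4} (g : ContDiffBump c₀) (h : ContDiffBump c₁)
    (x : Fin 2 → E4) : bumpTensor g h x = ((g (x 0) * h (x 1) : ℝ) : ℂ) := by
  simp [bumpTensor, Fin.prod_univ_two]

/-- Supports of the two bumps at distance: the tensor is off-diagonal. -/
theorem isOffDiagonal_bumpTensor {c₀ c₁ : E4} (g : ContDiffBump c₀) (h : ContDiffBump c₁)
    (hsep : g.rOut + h.rOut < ‖c₀ - c₁‖) : IsOffDiagonal (bumpTensor g h) := by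
  refine IsOffDiagonal.of_tsupport_subset ?_
  -- the closed set containing the support
  let S : Set (Fin 2 → E4) := {x | x 0 ∈ Metric.closedBall c₀ g.rOut ∧ x 1 ∈ Metric.closedBall c₁ h.rOut}
  have hS : IsClosed S := by
    have h0 : Continuous fun x : Fin 2 → E4 => x 0 := continuous_apply 0
    have h1 : Continuous fun x : Fin 2 → E4 => x 1 := continuous_apply 1
    exact (Metric.isClosed_closedBall.preimage h0).inter (Metric.isClosed_closedBall.preimage h1)
  have hsub : Function.support (bumpTensor g h : (Fin 2 → E4) → ℂ) ⊆ S := by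
    intro x hx
    rw [Function.mem_support, bumpTensor_apply] at hx
    have hx' : g (x 0) * h (x 1) ≠ 0 := by exact_mod_cast hx
    obtain ⟨hg, hh⟩ := mul_ne_zero_iff.1 hx'
    have hg' : x 0 ∈ Function.support g := hg
    have hh' : x 1 ∈ Function.support h := hh
    rw [ContDiffBump.support_eq] at hg' hh'
    exact ⟨Metric.ball_subset_closedBall hg', Metric.ball_subset_closedBall hh'⟩
  intro x hx hloc
  have hxS : x ∈ S := (closure_minimal hsub hS) hx
  obtain ⟨i, j, hij, hxij⟩ := hloc
  have h01 : x 0 = x 1 := by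
    fin_cases i <;> fin_cases j
    · exact absurd rfl hij
    · exact hxij
    · exact hxij.symm
    · exact absurd rfl hij
  obtain ⟨h0, h1⟩ := hxS
  rw [Metric.mem_closedBall, h01] at h0
  rw [Metric.mem_closedBall] at h1
  have : ‖c₀ - c₁‖ ≤ g.rOut + h.rOut := by
    calc ‖c₀ - c₁‖ = dist c₀ c₁ := (dist_eq_norm _ _).symm
      _ ≤ dist c₀ (x 1) + dist (x 1) c₁ := dist_triangle _ _ _
      _ ≤ g.rOut + h.rOut := by rw [dist_comm] ; exact add_le_add h0 h1
  linarith

/-- **Pinning lemma.** A kernel continuous off `0` whose two-point functional vanishes on every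
off-diagonal test function vanishes off `0`. -/
theorem kernel_eq_zero_off_origin (K : E4 → ℝ) (hK : ContinuousOn K {x : E4 | x ≠ 0})
    (h0 : ∀ F : 𝓢((Fin 2 → E4), ℂ), IsOffDiagonal F →
      Integrable (fun x : Fin 2 → E4 => (K (x 0 - x 1) : ℂ) * F x) ∧
        ∫ x : Fin 2 → E4, (K (x 0 - x 1) : ℂ) * F x = 0) :
    ∀ x : E4, x ≠ 0 → K x = 0 := by
  intro x₀ hx₀
  by_contra hne
  set κ := K x₀ with hκdef
  have hκ : 0 < |κ| := abs_pos.2 hne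
  -- continuity of K at x₀
  have hopen : IsOpen {x : E4 | x ≠ 0} := isOpen_compl_singleton
  have hcont : ContinuousAt K x₀ := (hK x₀ hx₀).continuousAt (hopen.mem_nhds hx₀)
  obtain ⟨ρ, hρ, hρK⟩ := Metric.continuousAt_iff.1 hcont (|κ| / 2) (half_pos hκ)
  -- radius of the bumps
  have hn0 : 0 < ‖x₀‖ := norm_pos_iff.2 hx₀
  set r : ℝ := min (ρ / 4) (‖x₀‖ / 4) with hrdef
  have hr : 0 < r := lt_min (by linarith) (by linarith)
  have hrρ : r ≤ ρ / 4 := min_le_left _ _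
  have hrx : r ≤ ‖x₀‖ / 4 := min_le_right _ _
  let g : ContDiffBump x₀ := ⟨r / 2, r, by linarith, by linarith⟩
  let h : ContDiffBump (0 : E4) := ⟨r / 2, r, by linarith, by linarith⟩
  have hsep : g.rOut + h.rOut < ‖x₀ - 0‖ := by
    show r + r < ‖x₀ - 0‖; rw [sub_zero]; linarith
  obtain ⟨hint, hI⟩ := h0 (bumpTensor g h) (isOffDiagonal_bumpTensor g h hsep)
  -- the real integrand
  set fR : (Fin 2 → E4) → ℝ := fun x => K (x 0 - x 1) * (g (x 0) * h (x 1)) with hfR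
  have hfun : (fun x : Fin 2 → E4 => (K (x 0 - x 1) : ℂ) * bumpTensor g h x) =
      fun x => ((fR x : ℝ) : ℂ) := by
    funext x; rw [bumpTensor_apply]; push_cast; simp [fR]
  rw [hfun] at hint hI
  have hintR : Integrable fR := by
    have := hint.re
    simpa using this
  have hIR : ∫ x, fR x = 0 := by
    have h1 : ((∫ x, fR x : ℝ) : ℂ) = 0 := by rw [← integral_complex_ofReal]; exact hI
    exact_mod_cast h1
  -- lower bound ℓ ≤ κ * fR
  set ℓ : (Fin 2 → E4) → ℝ := fun x => κ ^ 2 / 2 * (g (x 0) * h (x 1)) with hℓ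
  have hℓ_le : ∀ x, ℓ x ≤ κ * fR x := by
    intro x
    by_cases hgh : g (x 0) * h (x 1) = 0
    · simp [ℓ, fR, hgh]
    obtain ⟨hg1, hh1⟩ := mul_ne_zero_iff.1 hgh
    have hg2 : x 0 ∈ Metric.ball x₀ r := by
      have : x 0 ∈ Function.support g := hg1
      rwa [ContDiffBump.support_eq] at this
    have hh2 : x 1 ∈ Metric.ball (0 : E4) r := by
      have : x 1 ∈ Function.support h := hh1
      rwa [ContDiffBump.support_eq] at this
    rw [Metric.mem_ball, dist_eq_norm] at hg2 hh2
    rw [sub_zero] at hh2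
    have hd : dist (x 0 - x 1) x₀ < ρ := by
      rw [dist_eq_norm]
      calc ‖x 0 - x 1 - x₀‖ = ‖(x 0 - x₀) - x 1‖ := by congr 1; abel
        _ ≤ ‖x 0 - x₀‖ + ‖x 1‖ := norm_sub_le _ _
        _ < r + r := add_lt_add hg2 hh2
        _ ≤ ρ := by linarith
    have hKx := hρK hd
    rw [Real.dist_eq] at hKx
    have hprod : 0 ≤ g (x 0) * h (x 1) := mul_nonneg g.nonneg h.nonneg
    have hkey : κ ^ 2 / 2 ≤ κ * K (x 0 - x 1) := by
      have h1 : |κ| * |K (x 0 - x 1) - κ| ≤ |κ| * (|κ| / 2) :=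
        mul_le_mul_of_nonneg_left hKx.le (abs_nonneg _)
      have h2 : -(|κ| * |K (x 0 - x 1) - κ|) ≤ κ * (K (x 0 - x 1) - κ) := by
        rw [← abs_mul]; exact neg_abs_le _
      have h3 : |κ| * |κ| = κ ^ 2 := by rw [← sq, sq_abs]
      nlinarith
    calc ℓ x = κ ^ 2 / 2 * (g (x 0) * h (x 1)) := rfl
      _ ≤ κ * K (x 0 - x 1) * (g (x 0) * h (x 1)) := mul_le_mul_of_nonneg_right hkey hprod
      _ = κ * fR x := by simp [fR]; ring
  -- ℓ is continuous, compactly supported, nonneg, positive at (x₀, 0)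
  have hℓ_cont : Continuous ℓ :=
    continuous_const.mul ((g.continuous.comp (continuous_apply 0)).mul
      (h.continuous.comp (continuous_apply 1)))
  have hℓ_supp : HasCompactSupport ℓ := by
    let B : Fin 2 → Set E4 := ![Metric.closedBall x₀ r, Metric.closedBall (0 : E4) r]
    refine HasCompactSupport.intro (K := Set.pi Set.univ B)
      (isCompact_univ_pi fun i => ?_) ?_
    · fin_cases i <;> exact isCompact_closedBall _ _
    · intro x hx
      rw [Set.mem_univ_pi, Fin.forall_fin_two] at hx
      simp only [ℓ]
      have : g (x 0) * h (x 1) = 0 := by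
        by_contra hgh
        obtain ⟨hg1, hh1⟩ := mul_ne_zero_iff.1 hgh
        have hg2 : x 0 ∈ Function.support g := hg1
        have hh2 : x 1 ∈ Function.support h := hh1
        rw [ContDiffBump.support_eq] at hg2 hh2
        exact hx ⟨Metric.ball_subset_closedBall hg2, Metric.ball_subset_closedBall hh2⟩
      rw [this, mul_zero]
  have hℓ_nonneg : 0 ≤ ℓ := fun x => by
    simp only [ℓ, Pi.zero_apply]; exact mul_nonneg (by positivity) (mul_nonneg g.nonneg h.nonneg)
  let xs : Fin 2 → E4 := ![x₀, 0]
  have hℓ_xs : ℓ xs ≠ 0 := by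
    have hg1 : g (xs 0) = 1 := g.one_of_mem_closedBall (by simpa [xs, g] using (half_pos hr).le)
    have hh1 : h (xs 1) = 1 := h.one_of_mem_closedBall (by simpa [xs, h] using (half_pos hr).le)
    simp only [ℓ, hg1, hh1, mul_one]
    positivity
  have hpos : 0 < ∫ x, ℓ x :=
    hℓ_cont.integral_pos_of_hasCompactSupport_nonneg_nonzero hℓ_supp hℓ_nonneg hℓ_xs
  have hle : ∫ x, ℓ x ≤ ∫ x, κ * fR x :=
    integral_mono_of_nonneg (Eventually.of_forall hℓ_nonneg) (hintR.const_mul κ)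
      (Eventually.of_forall hℓ_le)
  have hzero : ∫ x, κ * fR x = 0 := by rw [integral_const_mul, hIR, mul_zero]
  linarith [hle, hzero, hpos]

/-- **Kernel uniqueness.** Two kernels continuous off `0` representing the same two-point
functional on `⁰𝒮` agree off `0`. -/
theorem kernel_unique {T : TwoPointCLM} {K K' : E4 → ℝ}
    (hK : ContinuousOn K {x : E4 | x ≠ 0}) (hK' : ContinuousOn K' {x : E4 | x ≠ 0})
    (hrep : RepresentsCLM T K) (hrep' : RepresentsCLM T K') :
    ∀ x : E4, x ≠ 0 → K x = K' x := by
  have h := kernel_eq_zero_off_origin (fun x => K x - K' x) (hK.sub hK') (fun F hF => by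
    obtain ⟨h1, h2⟩ := hrep F hF
    obtain ⟨h1', h2'⟩ := hrep' F hF
    have hfun : (fun x : Fin 2 → E4 => (((fun x => K x - K' x) (x 0 - x 1) : ℝ) : ℂ) * F x) =
        fun x => (K (x 0 - x 1) : ℂ) * F x - (K' (x 0 - x 1) : ℂ) * F x := by
      funext x; push_cast; ring
    refine ⟨by rw [hfun]; exact h1.sub h1', ?_⟩
    rw [hfun, integral_sub h1 h1', ← h2, ← h2', sub_self])
  intro x hx
  exact sub_eq_zero.1 (h x hx)

/-- **The `∃ K` of the crux is a property of THE kernel.** If `S₁ 2` is represented on `⁰𝒮` by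
some kernel `K₀` continuous off `0` (e.g. the explicit lattice-limit kernel), then the conclusion of
the crux holds iff `K₀` itself obeys the bound `|K₀ x| ≤ C (1 + ‖x‖^(η-10))` for some `C`, `η > 0`. -/
theorem representsCLM_kernelData_iff {T : TwoPointCLM} {K₀ : E4 → ℝ}
    (hK₀ : ContinuousOn K₀ {x : E4 | x ≠ 0}) (hrep : RepresentsCLM T K₀) :
    (∃ (K : E4 → ℝ) (C η : ℝ), KernelData K C η ∧ RepresentsCLM T K) ↔
      ∃ C η : ℝ, KernelData K₀ C η := by
  constructor
  · rintro ⟨K, C, η, ⟨hη, hK, hb⟩, hrepK⟩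
    refine ⟨C, η, hη, hK₀, fun x hx => ?_⟩
    rw [← kernel_unique hK hK₀ hrepK hrep x hx]
    exact hb x hx
  · rintro ⟨C, η, hKD⟩
    exact ⟨K₀, C, η, hKD, hrep⟩

/-- Family version of `representsCLM_kernelData_iff`: given one continuous representing kernel `K₀`, the
conclusion of the crux for `S₁` holds iff `K₀` itself carries the bound. [folklore] -/
theorem kernelConclusion_iff_of_represents {S₁ : SchwingerFamily E4} {K₀ : E4 → ℝ}
    (hK₀ : ContinuousOn K₀ {x : E4 | x ≠ 0}) (hrep : Represents S₁ K₀) :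
    KernelConclusion S₁ ↔ ∃ C η : ℝ, KernelData K₀ C η := by
  rw [kernelConclusion_iff]
  constructor
  · rintro ⟨K, C, η, ⟨hη, hK, hb⟩, hrepK⟩
    refine ⟨C, η, hη, hK₀, fun x hx => ?_⟩
    rw [← kernel_unique hK hK₀ hrepK hrep x hx]
    exact hb x hx
  · rintro ⟨C, η, hKD⟩
    exact ⟨K₀, C, η, hKD, hrep⟩

end Pinning

end Summit.QuantumFields.YangMills.Theorems.CurvatureKernelBound.Negative
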